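import Summits.AtomisticToContinuum.HydrodynamicLimit.Theorems.OneFlightGossipEngineKacPairHeatFlux
import HarnessLib

/-!
# `OneFlightGossipEngine.KacPairHeatFlux`, the partner's half (stmt-AtomisticToContinuum-9534)

The item's docstring records that the pair heat-flux identity holds "the same for
`y' = ½(x+y) − ½‖x−y‖ ω` by symmetry of `ν`". This file lands that companion statement, which the
route's foreseen `TreeDampedGossip` induction (the `(2/3)`-damped gossip on ring-sparse schedules)
consumes together with `kacPairHeatFlux_proof`: for the SECOND outgoing velocity of a Kac collision,
`E[⟪y',e⟫ ‖y'‖²] = (E[⟪x,e⟫ ‖x‖²] + E[⟪y,e⟫ ‖y‖²]) / 3` as well.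

No symmetry is actually needed beyond what the kick layer `KacPair.kick_average` already used:
`V − h ω = V + (−h) ω` and the kick average depends on `h` only through `h²`.
-/

noncomputable section

namespace Summit.AtomisticToContinuum.HydrodynamicLimit.Theorems

open MeasureTheory RealInnerProductSpace
open Literature.MathematicalPhysics.KineticTheory

open KacPair in
/-- Companion of `kacPairHeatFlux_proof` for the partner velocity `y' = ½(x+y) − ½‖x−y‖ ω`: under
the hypotheses of `OneFlightGossipEngine.KacPairHeatFlux` (centred probability laws `μ, μ'` with
finite third moments; kick law `ν` a probability measure on the unit sphere, symmetric, isotropic),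
`∫∫∫ ⟪y',e⟫ ‖y'‖² dν dμ' dμ = (∫ ⟪x,e⟫‖x‖² dμ + ∫ ⟪y,e⟫‖y‖² dμ') / 3`. -/
theorem kacPairHeatFlux_partner (μ μ' ν : Measure V3) [IsProbabilityMeasure μ]
    [IsProbabilityMeasure μ'] [IsProbabilityMeasure ν]
    (hμ3 : Integrable (fun x : V3 => ‖x‖ ^ 3) μ) (hμ'3 : Integrable (fun y : V3 => ‖y‖ ^ 3) μ')
    (hμ0 : ∫ x, x ∂μ = 0) (hμ'0 : ∫ y, y ∂μ' = 0) (hν1 : ∀ᵐ ω ∂ν, ‖ω‖ = 1)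
    (hνs : ν.map (fun ω => -ω) = ν)
    (hνiso : ∀ e : V3, ∫ ω, ⟪ω, e⟫ ^ 2 ∂ν = ‖e‖ ^ 2 / 3) (e : V3) :
    ∫ x, ∫ y, ∫ ω, ⟪(1 / 2 : ℝ) • (x + y) - (‖x - y‖ / 2) • ω, e⟫ *
        ‖(1 / 2 : ℝ) • (x + y) - (‖x - y‖ / 2) • ω‖ ^ 2 ∂ν ∂μ' ∂μ =
      ((∫ x, ⟪x, e⟫ * ‖x‖ ^ 2 ∂μ) + (∫ y, ⟪y, e⟫ * ‖y‖ ^ 2 ∂μ')) / 3 := by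
  have hω : ∀ x y : V3,
      ∫ ω, ⟪(1 / 2 : ℝ) • (x + y) - (‖x - y‖ / 2) • ω, e⟫ *
          ‖(1 / 2 : ℝ) • (x + y) - (‖x - y‖ / 2) • ω‖ ^ 2 ∂ν =
        ⟪(1 / 2 : ℝ) • (x + y), e⟫ *
          (‖(1 / 2 : ℝ) • (x + y)‖ ^ 2 + 5 / 3 * (‖x - y‖ / 2) ^ 2) := by
    intro x y
    have hsub : ∀ ω : V3, (1 / 2 : ℝ) • (x + y) - (‖x - y‖ / 2) • ω =
        (1 / 2 : ℝ) • (x + y) + (-(‖x - y‖ / 2)) • ω := fun ω => by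
      rw [neg_smul, sub_eq_add_neg]
    simp_rw [hsub]
    rw [kick_average hν1 hνs hνiso, neg_sq]
  simp_rw [hω, layer_y hμ'3 hμ'0]
  exact layer_x hμ3 hμ0 e _ _ _

end Summit.AtomisticToContinuum.HydrodynamicLimit.Theorems
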